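import Mathlib

/-!
# Explicit square roots in the cyclic group algebra `K[X]/(X^p − 1)` (tool lemma (N2) of line `Sketch`,
# crux `FeketeSOS.SublinearShadow`, stmt-ValiantsHypothesis-14990; lead c11)

In characteristic `p`, Frobenius collapses modulo `X^p − 1`: for every polynomial `G`,
`G^p ≡ (G(1))^p (mod X^p − 1)` (because `G^p − C (G 1)^p = (G − C (G 1))^p` and `X − 1 ∣ G − C (G 1)`, while
`(X − 1)^p = X^p − 1`).  Consequently a CYCLIC SQUARE ROOT IS EXPLICIT: if `X^p − 1 ∣ G² − Φ` then

  `X^p − 1 ∣ C (G(1)^p) · G − Φ^((p+1)/2)`   (`p` odd),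

i.e. every square `G` of non-zero mass `G(1)` occurring in a cyclic characteristic-`p` identity is DETERMINED, up to
the scalar `G(1)^p`, by what it squares to ("Euler's criterion in the group algebra": the group `1 + 𝔪` of
`K[X]/((X−1)^p)` has exponent `p`, so `u ↦ u^((p+1)/2)` is the square root on it).  Two corollaries used by the line:
* uniqueness — two cyclic square roots of the same `Φ` are proportional (`csq_sqrt_unique`);
* in a product-plus-square representation `A·B + c·G² ≡ T (mod X^p − 1)` (the `s = 3` front of the crux's
  residual W6, and the first open case of the sibling crux (★) `CharPSparseSOS`) the square is determined by the
  product: `G(1)^p · G ≡ (c⁻¹(T − A·B))^((p+1)/2)` (`stub_squareDeterminedByProduct`).  For the Fekete target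
  `T = κ·F̄_p` this turns the three-object problem into a two-object one and is what the lead's kit census
  (j025656/j025657) enumerates.
-/

namespace Summit.ValiantsHypothesis.ValiantsHypothesis.Theorems.SublinearShadowSketch

open Polynomial

-- `Summit.ValiantsHypothesis.ValiantsHypothesis.…` is the tree's mandated single-conjunct layout (Sub = Summit).
set_option linter.dupNamespace false

/-- **Frobenius collapses modulo `X^p − 1`.**  Over a commutative ring of prime characteristic `p`, every
polynomial `G` satisfies `X^p − 1 ∣ G^p − C (G(1)^p)`: indeed `G^p − C (G 1)^p = (G − C (G 1))^p`, `X − 1`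
divides `G − C (G 1)`, and `(X − 1)^p = X^p − 1`. [folklore] -/
theorem csq_X_pow_sub_one_dvd_pow_sub (K : Type*) [CommRing K] (p : ℕ) [Fact p.Prime] [CharP K p]
    (G : K[X]) : (X : K[X]) ^ p - 1 ∣ G ^ p - C ((G.eval 1) ^ p) := by
  have hXp : (X - C (1 : K)) ^ p = X ^ p - 1 := by
    rw [sub_pow_char, ← C_pow, one_pow, C_1]
  have h1 : G ^ p - C ((G.eval 1) ^ p) = (G - C (G.eval 1)) ^ p := by
    rw [C_pow, sub_pow_char]
  have h2 : X - C (1 : K) ∣ G - C (G.eval 1) := by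
    rw [dvd_iff_isRoot]
    simp
  rw [h1, ← hXp]
  exact pow_dvd_pow_of_dvd h2 p

/-- **Tool stub (N2): THE EXPLICIT CYCLIC SQUARE ROOT.**  Over a commutative ring of odd prime characteristic
`p`: if `X^p − 1 ∣ G² − Φ` then `X^p − 1 ∣ C (G(1)^p) · G − Φ^((p+1)/2)`.  Proof: `G² − Φ` divides
`(G²)^((p+1)/2) − Φ^((p+1)/2)`, `(G²)^((p+1)/2) = G^p · G`, and `G^p ≡ C (G(1)^p)` by
`csq_X_pow_sub_one_dvd_pow_sub`. [folklore: Euler's criterion in `K[X]/(X^p − 1)`] -/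
theorem stub_cyclicSqrt : ∀ (K : Type) [CommRing K] (p : ℕ) [Fact p.Prime] [CharP K p], p ≠ 2 →
    ∀ (G Φ : Polynomial K), (Polynomial.X : Polynomial K) ^ p - 1 ∣ G ^ 2 - Φ →
      (Polynomial.X : Polynomial K) ^ p - 1 ∣ Polynomial.C ((Polynomial.eval 1 G) ^ p) * G - Φ ^ ((p + 1) / 2) := by
  intro K _ p _ _ hp G Φ h
  have hodd : p % 2 = 1 := (Fact.out : p.Prime).eq_two_or_odd.resolve_left hp
  have hp1 : 2 * ((p + 1) / 2) = p + 1 := by omega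
  have hA : G ^ 2 - Φ ∣ (G ^ 2) ^ ((p + 1) / 2) - Φ ^ ((p + 1) / 2) := sub_dvd_pow_sub_pow _ _ _
  have hB : (G ^ 2) ^ ((p + 1) / 2) = G ^ p * G := by rw [← pow_mul, hp1, pow_succ]
  have hC := csq_X_pow_sub_one_dvd_pow_sub K p G
  have hE : C ((G.eval 1) ^ p) * G - Φ ^ ((p + 1) / 2)
      = ((G ^ 2) ^ ((p + 1) / 2) - Φ ^ ((p + 1) / 2)) - (G ^ p - C ((G.eval 1) ^ p)) * G := by
    rw [hB]; ring
  rw [hE]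
  exact dvd_sub (dvd_trans h hA) (dvd_mul_of_dvd_left hC _)

/-- **Cyclic square roots are unique up to scalars.**  If `G₁² ≡ Φ ≡ G₂² (mod X^p − 1)` then
`G₁(1)^p · G₁ ≡ G₂(1)^p · G₂ (mod X^p − 1)`; in particular two square roots of NON-ZERO MASS of the same element
of `K[X]/(X^p − 1)` are proportional. [folklore] -/
theorem csq_sqrt_unique (K : Type) [CommRing K] (p : ℕ) [Fact p.Prime] [CharP K p] (hp : p ≠ 2)
    (G₁ G₂ Φ : K[X]) (h₁ : (X : K[X]) ^ p - 1 ∣ G₁ ^ 2 - Φ) (h₂ : (X : K[X]) ^ p - 1 ∣ G₂ ^ 2 - Φ) :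
    (X : K[X]) ^ p - 1 ∣ C ((G₁.eval 1) ^ p) * G₁ - C ((G₂.eval 1) ^ p) * G₂ := by
  have e : C ((G₁.eval 1) ^ p) * G₁ - C ((G₂.eval 1) ^ p) * G₂
      = (C ((G₁.eval 1) ^ p) * G₁ - Φ ^ ((p + 1) / 2)) - (C ((G₂.eval 1) ^ p) * G₂ - Φ ^ ((p + 1) / 2)) := by
    ring
  rw [e]
  exact dvd_sub (stub_cyclicSqrt K p hp G₁ Φ h₁) (stub_cyclicSqrt K p hp G₂ Φ h₂)

/-- **In a cyclic product-plus-square identity the square is determined by the product.**  Over a field of odd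
prime characteristic `p`: if `X^p − 1 ∣ A·B + c·G² − T` with `c ≠ 0`, then
`X^p − 1 ∣ C (G(1)^p) · G − (C c⁻¹ · (T − A·B))^((p+1)/2)`.  (For `T = κ F̄_p` and sparse `A, B` this is the
`s = 3` configuration of the Fekete cruxes: once the product is fixed, the square — and hence its sparsity — is
forced, whenever `G(1) ≠ 0`, i.e. `A(1)B(1) ≠ T(1) = 0`.) [folklore] -/
theorem stub_squareDeterminedByProduct : ∀ (K : Type) [Field K] (p : ℕ) [Fact p.Prime] [CharP K p], p ≠ 2 →
    ∀ (A B G T : Polynomial K) (c : K), c ≠ 0 →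
      (Polynomial.X : Polynomial K) ^ p - 1 ∣ A * B + Polynomial.C c * G ^ 2 - T →
      (Polynomial.X : Polynomial K) ^ p - 1 ∣
        Polynomial.C ((Polynomial.eval 1 G) ^ p) * G - (Polynomial.C c⁻¹ * (T - A * B)) ^ ((p + 1) / 2) := by
  intro K _ p _ _ hp A B G T c hc h
  apply stub_cyclicSqrt K p hp
  have e : G ^ 2 - C c⁻¹ * (T - A * B) = C c⁻¹ * (A * B + C c * G ^ 2 - T) + (1 - C c⁻¹ * C c) * G ^ 2 := by
    ring
  have hcc : (1 : K[X]) - C c⁻¹ * C c = 0 := by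
    rw [← C_mul, inv_mul_cancel₀ hc, C_1, sub_self]
  rw [e, hcc, zero_mul, add_zero]
  exact dvd_mul_of_dvd_right h _

end Summit.ValiantsHypothesis.ValiantsHypothesis.Theorems.SublinearShadowSketch
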